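import Summits.QuantumFields.YangMills.Theorems.FluctuationComparisonRegPrIntLS2BetaGeodesicInterpolationSU2
import Summits.QuantumFields.YangMills.Theorems.FluctuationComparisonRegPrIntLS2BetaExpChartLipschitzOffCap
import HarnessLib

/-!
# S2β · D-GUARD ∕ (BG∞) — THE CONE FILLING TOWARD A CENTRE: stages T (tube) and S (sphere) of the 8-colour gluing WITHOUT THE LATTICE — boundary data
# `(π − r)`-inside the chart at `a` are contracted along `k = 0 … n` by `w(q, k) := a·expPoint((1 − k∕n)·logVec(a⁻¹q))`, with the radial step `(π − r)∕n`,
# the tangential factor `(1 − k∕n)·(π − r)∕sin r`, and the position invariant `arc(a⁻¹ w) = (1 − k∕n)·arc(a⁻¹ q)` (UV3-NODE §116.3 (G7), index-free core)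

Cell `ym3-torus` (YM ladder rung R3 = continuum `SU(2)` Yang–Mills on the three-torus at fixed lattice data — a RUNG: NOT d = 4, NOT infinite volume,
NOT a mass gap, NOT Clay).  Width seat «width 19» `ym3-torus-px19` (gen 25, ★p1 lineage), FREE px helper on crux `stmt-QuantumFields-20520`
(`FluctuationComparisonRegPrIntL`; registry `Lines/semiclassical_s2beta.lean` UNTOUCHED, 0∕5); `--kind proof --supports stmt-QuantumFields-20520 --as helper`,
count-neutral, DEFINITION-FREE (0 `def`, 0 `instance`, 0 `notation`, 0 `sorry`, default heartbeats).  Own-risk pen «(G7-C)ᵃᵇˢ» announced STATUS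
2026-09-01T00:45:04Z, sibling of px5 g24's (G7-I)ᵃᵇˢ «two-leg filling» (same letter shapes: the interpolant TERM `b * expPoint (s • logVec (su2Quat (b⁻¹ * t)))`
of ✓p838808 `…GeodesicInterpolationSU2`, here with base `a` = the cone centre and parameter `s = 1 − k∕n`).

WHY.  In the (BG∞) gluing (UV3-NODE §116.3) the classes 110∕101∕011 see a prescribed TUBE and class 111 a prescribed SPHERE of block-boundary values
`φ : Z → SU(2)`; both are filled by CONING toward a centre `a` in whose chart the whole family lies `(π − r)`-inside (`a` := the antipode of a point missed by the
family: ✓px5 `…HaarCapComplement` ∕ ✓LEAD `…FarPointPigeonhole`+`…SeparatedGridSU2`, then ⧗`…AntipodalConeCentre.exists_coneCentre_of_patched`).  The lattice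
bookkeeping (G6)∕(G7)-lattice then sets `Z :=` the ring-0 ∕ shell-0 sites, `k :=` the depth of an interior site and `z :=` its radial projection; what it needs
from the sphere is exactly the four facts below, uniformly in `Z` (an arbitrary index type — no adjacency structure enters).

WHAT IS PROVED (sorry-free; `X_q := logVec (su2Quat (a⁻¹ * q))`, `w(q,k) := a * expPoint ((1 − k∕n) • X_q)`, all written out).
* §1 `coneFill_zero` (`w(q,0) = q`), `coneFill_apex` (`w(q,n) = a`, `n ≠ 0`), ★ `norm_logVec_inv_mul_coneFill` (POSITION `‖logVec(a⁻¹ w(q,k))‖ = (1 − k∕n)·‖X_q‖`,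
  `k ≤ n`), `norm_logVec_inv_mul_coneFill_le` (so the filling stays `(π − r)`-inside whenever the datum does).
* §2 ★★ `dist1_coneFill_radial_le` (RADIAL `dist1 (w(q,k)·w(q,k+1)⁻¹) ≤ (π − r)∕n` from `‖X_q‖ ≤ π − r`; ✓`dist1_interp_step_le`).
* §3 ★★★ `dist1_coneFill_tangential_le` (TANGENTIAL `dist1 (w(q,k)·w(q′,k)⁻¹) ≤ (1 − k∕n)·((π − r)∕sin r)·dist1 (q·q′⁻¹)` for `‖X_q‖, ‖X_{q′}‖ ≤ π − r`, `k ≤ n`;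
  ✓p838790 `dist1_cone_mul_inv_cone_le`), `dist1_coneFill_tangential_le'` (the `k`-free bound `≤ ((π − r)∕sin r)·dist1 (q·q′⁻¹)`).
* §4 ★★ `dist1_coneFill_diagonal_le` (one depth step AND one boundary step: `≤ (π − r)∕n + ((π − r)∕sin r)·dist1 (q·q′⁻¹)` — the shape a lattice bond between
  sites of adjacent depth and adjacent projection consumes).

HONEST SCOPE.  Assembly of landed sphere geometry (✓p838808, ✓p838790); no lattice, no blocks, no gauge field; nothing of Bałaban's renormalisation-group analysis
is asserted or proved ([Balaban1985RegularSpaces] (1.29) p.81, Thm 2 p.83 — the local gauges the road globalises).  (BG∞) ∕ `hsupp⁺` is a CONJECTURE (LEAD §114.3,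
plan §116, FL-39 alive) and is NOT proved; (G6), (G7)-lattice, (G8)'s filing and Case S are OPEN; GAP♯∘ (`stub_uniformFibreGapOrbit`, registry UNTOUCHED), the five
registered stubs (0∕5), S2β, 20520, 19936, 19200, `YM3TorusSU2` are NOT proved; no registered stub is closed; rung R3 — NOT d = 4, NOT infinite volume, NOT a mass
gap, NOT Clay; the Yang–Mills mass gap is NOT proved.  Axioms standard.

References: T. Bałaban, CMP **99** (1985) 75–102 [Balaban1985RegularSpaces] ((1.29) p.81, Thm 2 p.83); I. Chevyrev, CMP **372** (2019), Lemma 4.14; G. Chambers,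
D. Dotterrer, F. Manin, S. Weinberger, JAMS **31** (2018) (quantitative null-homotopies — what these explicit cones replace at our fixed scale).
-/

set_option autoImplicit false

noncomputable section

namespace Summit.QuantumFields.YangMills.Theorems.FluctuationComparisonRegPrIntLS2BetaConeFilling

open scoped Real
open Literature.MathematicalPhysics.QuantumLattice (su2Quat)
open Literature.MathematicalPhysics.QuantumFieldTheory.Balaban1983to89
open T4CubeChartGnomonic (SU2)
open T4HaarSU2ExpChart (expPoint)
open T4ExpWindowSmallField (logVec norm_logVec_le_pi)
open Summit.QuantumFields.YangMills.Theorems.FluctuationComparisonRegPrIntLS2BetaGeodesicInterpolationSU2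
  (interp_zero interp_one norm_logVec_inv_mul_interp dist1_interp_step_le)
open Summit.QuantumFields.YangMills.Theorems.FluctuationComparisonRegPrIntLS2BetaExpChartLipschitzOffCap (dist1_cone_mul_inv_cone_le)

/-! ## §1 Endpoints and position -/

/-- The depth parameter: `1 − k∕n − (1 − (k+1)∕n) = 1∕n`. [folklore] -/
theorem depth_sub_depth_succ (n k : ℕ) : (1 - (k : ℝ) / n) - (1 - ((k + 1 : ℕ) : ℝ) / n) = 1 / n := by
  push_cast
  ring

/-- `0 ≤ 1 − k∕n` for `k ≤ n`. [folklore] -/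
theorem depth_nonneg {n k : ℕ} (hk : k ≤ n) : 0 ≤ 1 - (k : ℝ) / n := by
  rcases Nat.eq_zero_or_pos n with hn | hn
  · subst hn
    have : k = 0 := Nat.le_zero.1 hk
    simp [this]
  · have hn' : (0 : ℝ) < n := by exact_mod_cast hn
    have hkn : (k : ℝ) ≤ n := by exact_mod_cast hk
    rw [sub_nonneg, div_le_one hn']
    exact hkn

/-- `1 − k∕n ≤ 1`. [folklore] -/
theorem depth_le_one (n k : ℕ) : 1 - (k : ℝ) / n ≤ 1 := by
  have : 0 ≤ (k : ℝ) / n := by positivity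
  linarith

/-- **BOUNDARY**: at depth `0` the cone is the datum, `w(q, 0) = q`. [folklore] -/
theorem coneFill_zero (a q : SU2) (n : ℕ) :
    a * expPoint ((1 - ((0 : ℕ) : ℝ) / n) • logVec (su2Quat (a⁻¹ * q))) = q := by
  rw [Nat.cast_zero, zero_div, sub_zero]
  exact interp_one a q

/-- **APEX**: at depth `n` the cone is the centre, `w(q, n) = a` (`n ≠ 0`). [folklore] -/
theorem coneFill_apex (a q : SU2) {n : ℕ} (hn : n ≠ 0) :
    a * expPoint ((1 - ((n : ℕ) : ℝ) / n) • logVec (su2Quat (a⁻¹ * q))) = a := by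
  have hn' : (n : ℝ) ≠ 0 := by exact_mod_cast hn
  rw [div_self hn', sub_self]
  exact interp_zero a q

/-- ★ **POSITION**: `‖logVec (a⁻¹·w(q,k))‖ = (1 − k∕n)·‖logVec (a⁻¹ q)‖` for `k ≤ n`. [folklore] -/
theorem norm_logVec_inv_mul_coneFill (a q : SU2) {n k : ℕ} (hk : k ≤ n) :
    ‖logVec (su2Quat (a⁻¹ * (a * expPoint ((1 - (k : ℝ) / n) • logVec (su2Quat (a⁻¹ * q))))))‖ =
      (1 - (k : ℝ) / n) * ‖logVec (su2Quat (a⁻¹ * q))‖ :=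
  norm_logVec_inv_mul_interp a q (depth_nonneg hk) (depth_le_one n k)

/-- The filling stays `(π − r)`-inside the chart at `a` whenever the datum does (the «no cut locus» invariant passed to the next depth). [folklore] -/
theorem norm_logVec_inv_mul_coneFill_le (a q : SU2) {n k : ℕ} (hk : k ≤ n) {R : ℝ} (hq : ‖logVec (su2Quat (a⁻¹ * q))‖ ≤ R) :
    ‖logVec (su2Quat (a⁻¹ * (a * expPoint ((1 - (k : ℝ) / n) • logVec (su2Quat (a⁻¹ * q))))))‖ ≤ R := by
  rw [norm_logVec_inv_mul_coneFill a q hk]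
  have h0 : 0 ≤ ‖logVec (su2Quat (a⁻¹ * q))‖ := norm_nonneg _
  have h1 := depth_le_one n k
  have h2 := depth_nonneg hk
  nlinarith

/-! ## §2 The radial step -/

/-- ★★ **RADIAL STEP**: `dist1 (w(q,k)·w(q,k+1)⁻¹) ≤ (π − r)∕n` when the datum is `(π − r)`-inside the chart (`0 < n`). [cite: Balaban1985RegularSpaces, (1.29) p.81] -/
theorem dist1_coneFill_radial_le (a q : SU2) {n : ℕ} (hn : 0 < n) (k : ℕ) {r : ℝ} (hq : ‖logVec (su2Quat (a⁻¹ * q))‖ ≤ π - r) :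
    dist1 (a * expPoint ((1 - (k : ℝ) / n) • logVec (su2Quat (a⁻¹ * q))) *
        (a * expPoint ((1 - ((k + 1 : ℕ) : ℝ) / n) • logVec (su2Quat (a⁻¹ * q))))⁻¹) ≤ (π - r) / n := by
  have h := dist1_interp_step_le a q (1 - (k : ℝ) / n) (1 - ((k + 1 : ℕ) : ℝ) / n)
  rw [depth_sub_depth_succ, abs_of_pos (by positivity : (0 : ℝ) < 1 / n)] at h
  have hn' : (0 : ℝ) < n := by exact_mod_cast hn
  calc _ ≤ 1 / n * ‖logVec (su2Quat (a⁻¹ * q))‖ := h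
    _ ≤ 1 / n * (π - r) := mul_le_mul_of_nonneg_left hq (by positivity)
    _ = (π - r) / n := by ring

/-! ## §3 The tangential step -/

/-- ★★★ **TANGENTIAL STEP**: at depth `k ≤ n`, `dist1 (w(q,k)·w(q′,k)⁻¹) ≤ (1 − k∕n)·((π − r)∕sin r)·dist1 (q·q′⁻¹)` for data `(π − r)`-inside the chart at `a`
(`0 < r < π`) — ✓p838790's cone lemma at `s = 1 − k∕n`. [cite: Balaban1985RegularSpaces, Thm 2 p.83] -/
theorem dist1_coneFill_tangential_le {r : ℝ} (hr : 0 < r) (hrπ : r < π) (a q q' : SU2)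
    (hq : ‖logVec (su2Quat (a⁻¹ * q))‖ ≤ π - r) (hq' : ‖logVec (su2Quat (a⁻¹ * q'))‖ ≤ π - r) {n k : ℕ} (hk : k ≤ n) :
    dist1 (a * expPoint ((1 - (k : ℝ) / n) • logVec (su2Quat (a⁻¹ * q))) *
        (a * expPoint ((1 - (k : ℝ) / n) • logVec (su2Quat (a⁻¹ * q'))))⁻¹) ≤
      (1 - (k : ℝ) / n) * ((π - r) / Real.sin r) * dist1 (q * q'⁻¹) :=
  dist1_cone_mul_inv_cone_le hr hrπ a q q' hq hq' (depth_nonneg hk)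

/-- The depth-free tangential bound `≤ ((π − r)∕sin r)·dist1 (q·q′⁻¹)`. [cite: Balaban1985RegularSpaces, Thm 2 p.83] -/
theorem dist1_coneFill_tangential_le' {r : ℝ} (hr : 0 < r) (hrπ : r < π) (a q q' : SU2)
    (hq : ‖logVec (su2Quat (a⁻¹ * q))‖ ≤ π - r) (hq' : ‖logVec (su2Quat (a⁻¹ * q'))‖ ≤ π - r) {n k : ℕ} (hk : k ≤ n) :
    dist1 (a * expPoint ((1 - (k : ℝ) / n) • logVec (su2Quat (a⁻¹ * q))) *
        (a * expPoint ((1 - (k : ℝ) / n) • logVec (su2Quat (a⁻¹ * q'))))⁻¹) ≤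
      ((π - r) / Real.sin r) * dist1 (q * q'⁻¹) := by
  refine (dist1_coneFill_tangential_le hr hrπ a q q' hq hq' hk).trans ?_
  have hΛ : 0 ≤ (π - r) / Real.sin r := div_nonneg (by linarith) (Real.sin_pos_of_pos_of_lt_pi hr hrπ).le
  have hd : 0 ≤ dist1 (q * q'⁻¹) := GaugeGroup.dist1_nonneg _
  have h1 := depth_le_one n k
  have : (1 - (k : ℝ) / n) * ((π - r) / Real.sin r) * dist1 (q * q'⁻¹) ≤ 1 * ((π - r) / Real.sin r) * dist1 (q * q'⁻¹) :=
    mul_le_mul_of_nonneg_right (mul_le_mul_of_nonneg_right h1 hΛ) hd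
  linarith

/-! ## §4 The diagonal step (what a lattice bond between adjacent depths and adjacent projections consumes) -/

/-- `dist1 (A·C⁻¹) ≤ dist1 (A·B⁻¹) + dist1 (B·C⁻¹)`. [cite: Balaban1985Averaging, (19)-(20) p.21] -/
theorem dist1_mul_inv_le_via {G : Type*} [GaugeGroup G] (A B C : G) : dist1 (A * C⁻¹) ≤ dist1 (A * B⁻¹) + dist1 (B * C⁻¹) := by
  have e : A * C⁻¹ = A * B⁻¹ * (B * C⁻¹) := by group
  rw [e]
  exact GaugeGroup.dist1_mul_le _ _

/-- ★★ **DIAGONAL STEP**: `dist1 (w(q,k)·w(q′,k+1)⁻¹) ≤ ((π − r)∕sin r)·dist1 (q·q′⁻¹) + (π − r)∕n` (`k + 1 ≤ n`): one tangential step at depth `k`, then one radial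
step along `q′`. [cite: Balaban1985RegularSpaces, Thm 2 p.83] -/
theorem dist1_coneFill_diagonal_le {r : ℝ} (hr : 0 < r) (hrπ : r < π) (a q q' : SU2)
    (hq : ‖logVec (su2Quat (a⁻¹ * q))‖ ≤ π - r) (hq' : ‖logVec (su2Quat (a⁻¹ * q'))‖ ≤ π - r) {n k : ℕ} (hk : k + 1 ≤ n) :
    dist1 (a * expPoint ((1 - (k : ℝ) / n) • logVec (su2Quat (a⁻¹ * q))) *
        (a * expPoint ((1 - ((k + 1 : ℕ) : ℝ) / n) • logVec (su2Quat (a⁻¹ * q'))))⁻¹) ≤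
      ((π - r) / Real.sin r) * dist1 (q * q'⁻¹) + (π - r) / n := by
  have hn : 0 < n := by omega
  have h1 := dist1_coneFill_tangential_le' hr hrπ a q q' hq hq' (by omega : k ≤ n)
  have h2 := dist1_coneFill_radial_le a q' hn k hq'
  exact (dist1_mul_inv_le_via _ _ _).trans (add_le_add h1 h2)

end Summit.QuantumFields.YangMills.Theorems.FluctuationComparisonRegPrIntLS2BetaConeFilling

end
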